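import Summits.QuantumFields.BalabanUV.Beta.CombMixedT2EvenPeriodised
import Summits.QuantumFields.BalabanUV.Beta.CompositeMixedTable
import Summits.QuantumFields.BalabanUV.Beta.GAN24.SymLinKernelExpansion

/-!
# `BalabanUV.Beta.CombMixedT2EvenStoreyTwoLetters` — binder row D1 ∕ (C1), PART 30a (letters for PART 30b `CombMixedT2EvenStoreyTwo`): **(K2b) AT DEPTH 2 IS STOREYWISE — the fine pure-gauge row of the EVEN HALF of the literal's DEPTH-2 COMPOSITE
# mixed kernel `compMixKer ℓ 𝓋 𝒽 𝓉 Lc 2` (an1's (0.4)-SYM bricks at `ρ_c` at both levels) is MINUS the commutator taken LEVEL BY LEVEL, each level with the gauge function SAMPLED AT ITS OWN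
# BLOCK ROOTS: `Σ'_x Σ_α (λ(x+e_α) − λ x)·compMix₂ᵉ(μ,y; (α,x), f, f′) = Σ_{b₁,b₂} (Λ(u_{b₂}) − Λ(u_{b₁}))·h(μ,y;b₁,b₂)·ℓ(b₁;f)·ℓ(b₂;f′) + (λ(x_{f′}) − λ(x_f))·Σ_b ℓ(μ,y;b)·h(b;f,f′)`,
# `Λ(u) := λ(Lc•u + ρ_c)`** — Engine C's TIER V PHASE A closed form (`K2L-V-A.md` aa42349465e81665 §4, `γ = −1`, residual ≤ 1.9e−15) AS A THEOREM; the displayed single-generator form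
# `κ₂·[E_λ, compH₂]` is NOT what holds (by value residual 0.06–0.75; by this file the difference is the explicit storey term)

WHY (journal [AN2-G70-A3]; J-NOTE-14 `HOME/b2b-balaban-beta-an2/gen70/J14-K2B-STOREYWISE.md`).  PART 25∕26 settled (K2b) at depth 1 (pure commutator, finest generator).  At depth 2 the composite
mixed kernel is `compMixKer_succ`'s five summands; under the even half in the fluctuation pair S2+S3 and S4 are transpose-ODD (`h` antisymmetric) and vanish, S5 is the depth-1 letter at each
level-1 bond, and S1 is the depth-1 letter AT LEVEL 1 for the top brick fed the TRANSPORTED pure gauge `Σ_g ℓ(b;g)(Dλ)_g = Λ(u_b + e_κ) − Λ(u_b)` (GAN24 `tsum_sum_symLinKerAt_mul_grad`: an1's sym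
linear brick maps a finest pure gauge to the level-1 pure gauge of the ROOT-SAMPLED function).  So the Ward row of the composite is the sum over the two storeys of the storey's own
commutator — the covariant statement road FP's v6 should display for `hK2b` at depth ≥ 2 (its `Rs` is otherwise the explicit difference `D_λᵀ h L1 + L1ᵀ h D_λ`).

WHAT (`d = 3`, root `ρ_c = ctr 4 Lc = toSite (ctrOff 4 Lc)`, bricks `ℓ = symLinKerAt ρ_c Lc`, `𝓋 = symVhKerAt`, `𝒽 = symHessKerAt`, `𝓉 = symMixKerAt`, constant in the level index; [folklore] finite
re-indexing BY NAME; no `def`, no `def … : Prop`, nothing cited, 0 sorry):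
§1 `tsum_eq_sum_offs` (a `Near`-supported function's lattice sum is its window sum), **`tsum_sum_grad_mul_symMixKerAt_even`** — THE DEPTH-1 LETTER CONTRACTED WITH A GAUGE FUNCTION, in an1's
`KerAt` currency: `Σ'_u Σ_κ (λ(u+e_κ) − λ u)·½(t(μ,y;(κ,u),f,f′) + t(μ,y;(κ,u),f′,f)) = (λ x_{f′} − λ x_f)·h(μ,y;f,f′)` (PART 25 §3 at level 0 + GAN24's summation by parts
`tsum_sum_dz_mul_eq` + `tsum_mul_ite_sub_ite_mul`); §2 the five summands at depth 2 with the depth-1 composites replaced by bricks (`compLinKer_one ∕ compVHKer_one ∕ compMixKer_one`),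
the two PARITY KILLS `even(S2+S3) = 0`, `even(S4) = 0` (pointwise in the background bond; `symHessKerAt_swap` + `Finset.sum_comm`), hence `compMix₂ᵉ = even(S1) + even(S5)` pointwise;
(§3 — the display above — is PART 30b `CombMixedT2EvenStoreyTwo.tsum_sum_grad_mul_compMixKer_two_even`, which imports this file.)
WHAT THIS IS NOT: not the torus periodisation (PART 26's engine applies verbatim to each storey term — next); not depth ≥ 3 (induction over `compMixKer_succ` with (W-lin)_m); not (J-R₂) nor v6's
reshape (the road's call); nothing of Bałaban's asserted, valued or discharged; 0 estimates; 0∕4 row-D1 binders (hW, hR, D1Tel, D1Rep); ROOT M‴ p325680 ∕ P5c ∕ D6 untouched; NOT (C1), NOT (T-ID),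
NOT D1, NEVER «G-an2-4 closed», NOT BetaPertH, NOT continuum, NOT Clay.

HONEST DEPENDENCY (page 1, mandatory): continuum YM on T⁴ ⇐ BetaPertH ∧ nine spine estimates (0/9 proved); BetaPertH ⇐ (D1) ∧ (D4) ∧ CAP+tail;
G-an2-4 gates asym, D1 and NE2/3/4.  HONEST FRAMING (cell contract, verbatim): «discharging `BetaPertH` makes Bałaban's UV stability UNCONDITIONAL —
a real constructive-QFT result; it is NOT the continuum limit and NOT the Clay problem.»  ABSOLUTE RULE (cell charter, verbatim): «No internally-minted
statement may enter as a cited fact. Every hypothesis is either kernel-proved in this package or a verbatim quotation of a PUBLISHED theorem with page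
reference. The manuscript(s) under audit are NOT citable for their own disputed steps — they are the thing under adjudication; programme-internal
(2001/route/tribunal) claims are never citable.»  Row D1 ∕ (C1) OWNER an2 (b2b-balaban-beta-an2) gen 70, 2026-08-28.  No existing file touched.
-/

noncomputable section

open scoped BigOperators

namespace Summit.QuantumFields.BalabanUV.Beta.CombMixedT2EvenStoreyTwoLetters

open Finset
open Literature.MathematicalPhysics.QuantumFieldTheory
open Literature.MathematicalPhysics.QuantumFieldTheory.Balaban1983to89
open Literature.MathematicalPhysics.QuantumFieldTheory.Balaban1983to89.Beta
open AffineAveraging (Site box toSite unitVec dz)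
open AveragingContoursRooted (ctr ctrOff ctrOff_mem_box)
open AveragingHessianKernels (Bond Near)
open ExpKernelCalculus (MKer)
open OneStepResolventKernel (Fib)
open BalabanStepW2 (M2Of wM2)
open Summit.QuantumFields.BalabanUV.Beta.TameKernelCalculus (trK)
open Summit.QuantumFields.BalabanUV.Beta.BorderedHessian (sgnK)
open Summit.QuantumFields.BalabanUV.Beta.AxialDressingRooted (one_le_of_neZero)
open Summit.QuantumFields.BalabanUV.Beta.SymAveragingHessianCounts (symLinKerAt symVhKerAt symHessKerAt symHessFFAt symHessFFAt_inl_inl symHessKerAt_swap symLinKerAt_eq_zero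
  symVhKerAt_eq_zero_left symVhKerAt_eq_zero_right symHessKerAt_eq_zero_left symHessKerAt_eq_zero_right)
open Summit.QuantumFields.BalabanUV.Beta.SymAveragingMixedJetTables (symMixFFAt symMixKerAt)
open Summit.QuantumFields.BalabanUV.Beta.SymWardLettersAn1 (wM2_eq stepScale_zero wM1_zero)
open Summit.QuantumFields.BalabanUV.Beta.CompositeVertexKernelRec (offs compLinKer compVHKer compLinKer_one compVHKer_one near_iff_exists_offs near_smul_add_iff)
open Summit.QuantumFields.BalabanUV.Beta.CompositeMixedTable (compMixKer compMixKer_succ compMixKer_one)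
open Summit.QuantumFields.BalabanUV.Beta.CombMixedT2EvenSiteLetter (sum_mixedT2_even_sub_inl_inl)
open Summit.QuantumFields.BalabanUV.Beta.CombMixedT2EvenPeriodised (mixedT2_even_inl_inl symMixKerAt_eq_zero_of_not_near_left symMixKerAt_eq_zero_of_not_near_right
  symMixKerAt_eq_zero_of_not_near_bond)
open Summit.QuantumFields.BalabanUV.Beta.GAN24.BorderGaugeLegContact (tsum_sum_dz_mul_eq tsum_mul_ite_sub_ite_mul)
open Summit.QuantumFields.BalabanUV.Beta.GAN24.SymLinKernelExpansion (tsum_sum_symLinKerAt_mul_grad)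

variable {Lc : ℕ} [NeZero Lc]

/-! ## §1 Window sums; the depth-1 letter contracted with a gauge function, in an1's `KerAt` currency -/

omit [NeZero Lc] in
/-- [folklore] a function supported in an1's window `Near L y` has lattice sum = window sum over the offsets `offs L`. -/
theorem tsum_eq_sum_offs {L : ℕ} {y : Site (3 + 1)} (F : Site (3 + 1) → ℝ) (hF : ∀ u, ¬ Near L y u → F u = 0) :
    ∑' u : Site (3 + 1), F u = ∑ e ∈ offs L, F ((L : ℤ) • y + e) := by
  have hinj : Set.InjOn (fun e : Site (3 + 1) => (L : ℤ) • y + e) ↑(offs (d := 3) L) := fun a _ b _ h => add_left_cancel h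
  rw [← Finset.sum_image hinj]
  refine tsum_eq_sum fun u hu => hF u fun hnear => hu ?_
  obtain ⟨e, he, rfl⟩ := near_iff_exists_offs.1 hnear
  exact Finset.mem_image.2 ⟨e, he, rfl⟩

omit [NeZero Lc] in
/-- [folklore] the weight at level `0` is `1`: `M2Of 3 Lc t 0 κ u ρ w = t κ u ρ w`. -/
theorem M2Of_zero_apply (t : Fin (3 + 1) → Site (3 + 1) → Fin (3 + 1) → Site (3 + 1) → MKer (3 + 1) (Fib 3))
    (κ : Fin (3 + 1)) (u : Site (3 + 1)) (ρ : Fin (3 + 1)) (w : Site (3 + 1)) : M2Of 3 Lc t 0 κ u ρ w = t κ u ρ w := by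
  rw [WardLocusParityLevels.M2Of_apply, wM2_eq, stepScale_zero, wM1_zero, one_mul, one_smul]

/-- [folklore] **`tsum_sum_grad_mul_symMixKerAt_even` — THE DEPTH-1 LETTER CONTRACTED WITH A GAUGE FUNCTION** (PART 25 §3 at level 0, summed by parts against `λ`): for an1's sym mixed brick at
the centred root, every coarse bond `(μ, y)`, every pair of bonds `f, f′` and every function `λ` on sites,
`Σ'_u Σ_κ (λ(u+e_κ) − λ u) · ½(t(μ,y;(κ,u),f,f′) + t(μ,y;(κ,u),f′,f)) = (λ f′.2 − λ f.2) · h(μ,y;f,f′)` — the even table's fine pure-gauge row is MINUS the commutator `[E_λ, h]`. -/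
theorem tsum_sum_grad_mul_symMixKerAt_even (lam : Site (3 + 1) → ℝ) (μ : Fin (3 + 1)) (y : Site (3 + 1)) (f f' : Bond (3 + 1)) :
    ∑' u : Site (3 + 1), ∑ κ : Fin (3 + 1), (lam (u + unitVec κ) - lam u)
        * ((1 / 2 : ℝ) * (symMixKerAt (ctr 4 Lc) Lc μ y (κ, u) f f' + symMixKerAt (ctr 4 Lc) Lc μ y (κ, u) f' f))
      = (lam f'.2 - lam f.2) * symHessKerAt (ctr 4 Lc) Lc μ y f f' := by
  have hLc : 1 ≤ Lc := one_le_of_neZero Lc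
  -- the even table's `ff` entry as a function of the fine background bond
  set F : Fin (3 + 1) → Site (3 + 1) → ℝ := fun κ u =>
    (1 / 2 : ℝ) * (symMixKerAt (ctr 4 Lc) Lc μ y (κ, u) f f' + symMixKerAt (ctr 4 Lc) Lc μ y (κ, u) f' f) with hF
  have hFsupp : ∀ κ u, ¬ Near Lc y u → F κ u = 0 := fun κ u hu => by
    simp only [hF, show ctr 4 Lc = toSite (ctrOff 4 Lc) from rfl, symMixKerAt_eq_zero_of_not_near_bond (ctrOff_mem_box hLc) μ y (g := (κ, u)) hu, add_zero, mul_zero]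
  have hFsum : ∀ κ (g : Site (3 + 1) → ℝ), Summable fun u => g u * F κ u := fun κ g =>
    summable_of_ne_finset_zero (s := (offs Lc).image fun e => (Lc : ℤ) • y + e) fun u hu => by
      rw [hFsupp κ u (fun hn => hu ?_), mul_zero]
      obtain ⟨e, he, rfl⟩ := near_iff_exists_offs.1 hn
      exact Finset.mem_image.2 ⟨e, he, rfl⟩
  -- summation by parts
  have hparts := tsum_sum_dz_mul_eq F hFsum lam
  simp only [dz] at hparts
  rw [show (∑' u : Site (3 + 1), ∑ κ : Fin (3 + 1), (lam (u + unitVec κ) - lam u)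
        * ((1 / 2 : ℝ) * (symMixKerAt (ctr 4 Lc) Lc μ y (κ, u) f f' + symMixKerAt (ctr 4 Lc) Lc μ y (κ, u) f' f)))
      = ∑' u : Site (3 + 1), ∑ κ : Fin (3 + 1), (lam (u + unitVec κ) - lam u) * F κ u from rfl, hparts]
  -- PART 25 §3 at level 0, per site
  have hsite : ∀ w₀ : Site (3 + 1), ∑ κ : Fin (3 + 1), (F κ (w₀ - unitVec κ) - F κ w₀)
      = ((if f.2 = w₀ then (1 : ℝ) else 0) - (if f'.2 = w₀ then 1 else 0)) * (-symHessKerAt (ctr 4 Lc) Lc μ y f f') := fun w₀ => by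
    have h := sum_mixedT2_even_sub_inl_inl (Lc := Lc) 0 μ y w₀ f.2 f'.2 f.1 f'.1
    simp only [mixedT2_even_inl_inl] at h
    simp only [wM2_eq, stepScale_zero, wM1_zero, mul_one, one_mul, symHessFFAt_inl_inl, Prod.mk.eta] at h
    simpa only [hF] using h
  simp only [hsite]
  rw [show (fun w₀ : Site (3 + 1) => lam w₀ * (((if f.2 = w₀ then (1 : ℝ) else 0) - (if f'.2 = w₀ then 1 else 0)) * -symHessKerAt (ctr 4 Lc) Lc μ y f f'))
      = fun w₀ => lam w₀ * (((if f.2 = w₀ then (1 : ℝ) else 0) - (if f'.2 = w₀ then 1 else 0)) * -symHessKerAt (ctr 4 Lc) Lc μ y f f') from rfl,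
    tsum_mul_ite_sub_ite_mul lam f.2 f'.2]
  ring


/-! ## §2 The depth-2 composite mixed kernel over an1's sym bricks: five summands, two parity kills -/

/-- [folklore] support letters of the sym bricks at the centred root, in `compMixKer_one ∕ compLinKer_one ∕ compVHKer_one`'s hypothesis shapes. -/
theorem symLin_off (m : ℕ) (μ : Fin (3 + 1)) (y : Site (3 + 1)) (f : Bond (3 + 1)) (h : ¬ Near Lc y f.2) :
    (fun (_ : ℕ) => symLinKerAt (ctr 4 Lc) Lc) m μ y f = 0 :=
  symLinKerAt_eq_zero (ctrOff_mem_box (one_le_of_neZero Lc)) h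

/-- [folklore] (border brick, fluctuation slot). -/
theorem symVh_off_left (m : ℕ) (μ : Fin (3 + 1)) (y : Site (3 + 1)) (f f' : Bond (3 + 1)) (h : ¬ Near Lc y f.2) :
    (fun (_ : ℕ) => symVhKerAt (ctr 4 Lc) Lc) m μ y f f' = 0 :=
  symVhKerAt_eq_zero_left (ctrOff_mem_box (one_le_of_neZero Lc)) h f'

/-- [folklore] (border brick, background slot). -/
theorem symVh_off_right (m : ℕ) (μ : Fin (3 + 1)) (y : Site (3 + 1)) (f f' : Bond (3 + 1)) (h : ¬ Near Lc y f'.2) :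
    (fun (_ : ℕ) => symVhKerAt (ctr 4 Lc) Lc) m μ y f f' = 0 :=
  symVhKerAt_eq_zero_right (ctrOff_mem_box (one_le_of_neZero Lc)) f h

/-- [folklore] (Hessian brick, left). -/
theorem symHess_off_left (m : ℕ) (μ : Fin (3 + 1)) (y : Site (3 + 1)) (f f' : Bond (3 + 1)) (h : ¬ Near Lc y f.2) :
    (fun (_ : ℕ) => symHessKerAt (ctr 4 Lc) Lc) m μ y f f' = 0 :=
  symHessKerAt_eq_zero_left (ctrOff_mem_box (one_le_of_neZero Lc)) h f'

/-- [folklore] (Hessian brick, right). -/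
theorem symHess_off_right (m : ℕ) (μ : Fin (3 + 1)) (y : Site (3 + 1)) (f f' : Bond (3 + 1)) (h : ¬ Near Lc y f'.2) :
    (fun (_ : ℕ) => symHessKerAt (ctr 4 Lc) Lc) m μ y f f' = 0 :=
  symHessKerAt_eq_zero_right (ctrOff_mem_box (one_le_of_neZero Lc)) f h

/-- [folklore] (mixed brick, background ∕ left ∕ right slots). -/
theorem symMix_off₁ (m : ℕ) (μ : Fin (3 + 1)) (y : Site (3 + 1)) (g f f' : Bond (3 + 1)) (h : ¬ Near Lc y g.2) :
    (fun (_ : ℕ) => symMixKerAt (ctr 4 Lc) Lc) m μ y g f f' = 0 :=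
  symMixKerAt_eq_zero_of_not_near_bond (ctrOff_mem_box (one_le_of_neZero Lc)) μ y (g := g) h f f'

/-- [folklore] -/
theorem symMix_off₂ (m : ℕ) (μ : Fin (3 + 1)) (y : Site (3 + 1)) (g f f' : Bond (3 + 1)) (h : ¬ Near Lc y f.2) :
    (fun (_ : ℕ) => symMixKerAt (ctr 4 Lc) Lc) m μ y g f f' = 0 :=
  symMixKerAt_eq_zero_of_not_near_left (ctrOff_mem_box (one_le_of_neZero Lc)) μ y g (f := f) h f'

/-- [folklore] -/
theorem symMix_off₃ (m : ℕ) (μ : Fin (3 + 1)) (y : Site (3 + 1)) (g f f' : Bond (3 + 1)) (h : ¬ Near Lc y f'.2) :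
    (fun (_ : ℕ) => symMixKerAt (ctr 4 Lc) Lc) m μ y g f f' = 0 :=
  symMixKerAt_eq_zero_of_not_near_right (ctrOff_mem_box (one_le_of_neZero Lc)) μ y g f (f' := f') h

omit [NeZero Lc] in
/-- [folklore] exchanging the two bond pairs of a four-fold window sum. -/
theorem sum4_swap {L : ℕ} (F : Fin (3 + 1) → Site (3 + 1) → Fin (3 + 1) → Site (3 + 1) → ℝ) :
    (∑ κ₁ : Fin (3 + 1), ∑ e₁ ∈ offs L, ∑ κ₂ : Fin (3 + 1), ∑ e₂ ∈ offs L, F κ₁ e₁ κ₂ e₂)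
      = ∑ κ₁ : Fin (3 + 1), ∑ e₁ ∈ offs L, ∑ κ₂ : Fin (3 + 1), ∑ e₂ ∈ offs L, F κ₂ e₂ κ₁ e₁ := by
  have s1 : (∑ κ₁ : Fin (3 + 1), ∑ e₁ ∈ offs L, ∑ κ₂ : Fin (3 + 1), ∑ e₂ ∈ offs L, F κ₁ e₁ κ₂ e₂)
      = ∑ κ₁ : Fin (3 + 1), ∑ κ₂ : Fin (3 + 1), ∑ e₁ ∈ offs L, ∑ e₂ ∈ offs L, F κ₁ e₁ κ₂ e₂ :=
    Finset.sum_congr rfl fun κ₁ _ => Finset.sum_comm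
  have s2 : (∑ κ₁ : Fin (3 + 1), ∑ κ₂ : Fin (3 + 1), ∑ e₁ ∈ offs L, ∑ e₂ ∈ offs L, F κ₁ e₁ κ₂ e₂)
      = ∑ κ₂ : Fin (3 + 1), ∑ κ₁ : Fin (3 + 1), ∑ e₁ ∈ offs L, ∑ e₂ ∈ offs L, F κ₁ e₁ κ₂ e₂ := Finset.sum_comm
  have s3 : (∑ κ₂ : Fin (3 + 1), ∑ κ₁ : Fin (3 + 1), ∑ e₁ ∈ offs L, ∑ e₂ ∈ offs L, F κ₁ e₁ κ₂ e₂)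
      = ∑ κ₂ : Fin (3 + 1), ∑ κ₁ : Fin (3 + 1), ∑ e₂ ∈ offs L, ∑ e₁ ∈ offs L, F κ₁ e₁ κ₂ e₂ :=
    Finset.sum_congr rfl fun κ₂ _ => Finset.sum_congr rfl fun κ₁ _ => Finset.sum_comm
  have s4 : (∑ κ₂ : Fin (3 + 1), ∑ κ₁ : Fin (3 + 1), ∑ e₂ ∈ offs L, ∑ e₁ ∈ offs L, F κ₁ e₁ κ₂ e₂)
      = ∑ κ₂ : Fin (3 + 1), ∑ e₂ ∈ offs L, ∑ κ₁ : Fin (3 + 1), ∑ e₁ ∈ offs L, F κ₁ e₁ κ₂ e₂ :=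
    Finset.sum_congr rfl fun κ₂ _ => Finset.sum_comm
  rw [s1, s2, s3, s4]

omit [NeZero Lc] in
/-- [folklore] four nested window sums of a termwise-vanishing sum of four families vanish. -/
theorem sum4_eq_zero_of_add4 {L : ℕ} (A B C D : Fin (3 + 1) → Site (3 + 1) → Fin (3 + 1) → Site (3 + 1) → ℝ)
    (h : ∀ a b c e, A a b c e + B a b c e + C a b c e + D a b c e = 0) :
    (∑ κ₁ : Fin (3 + 1), ∑ e₁ ∈ offs L, ∑ κ₂ : Fin (3 + 1), ∑ e₂ ∈ offs L, A κ₁ e₁ κ₂ e₂)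
      + (∑ κ₁ : Fin (3 + 1), ∑ e₁ ∈ offs L, ∑ κ₂ : Fin (3 + 1), ∑ e₂ ∈ offs L, B κ₁ e₁ κ₂ e₂)
      + (∑ κ₁ : Fin (3 + 1), ∑ e₁ ∈ offs L, ∑ κ₂ : Fin (3 + 1), ∑ e₂ ∈ offs L, C κ₁ e₁ κ₂ e₂)
      + (∑ κ₁ : Fin (3 + 1), ∑ e₁ ∈ offs L, ∑ κ₂ : Fin (3 + 1), ∑ e₂ ∈ offs L, D κ₁ e₁ κ₂ e₂) = 0 := by
  have hc : (∑ κ₁ : Fin (3 + 1), ∑ e₁ ∈ offs L, ∑ κ₂ : Fin (3 + 1), ∑ e₂ ∈ offs L,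
      (A κ₁ e₁ κ₂ e₂ + B κ₁ e₁ κ₂ e₂ + C κ₁ e₁ κ₂ e₂ + D κ₁ e₁ κ₂ e₂)) = 0 :=
    Finset.sum_eq_zero fun a _ => Finset.sum_eq_zero fun b _ => Finset.sum_eq_zero fun c _ => Finset.sum_eq_zero fun e _ => h a b c e
  simpa only [Finset.sum_add_distrib] using hc

omit [NeZero Lc] in
/-- [folklore] two families. -/
theorem sum4_eq_zero_of_add2 {L : ℕ} (A B : Fin (3 + 1) → Site (3 + 1) → Fin (3 + 1) → Site (3 + 1) → ℝ)
    (h : ∀ a b c e, A a b c e + B a b c e = 0) :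
    (∑ κ₁ : Fin (3 + 1), ∑ e₁ ∈ offs L, ∑ κ₂ : Fin (3 + 1), ∑ e₂ ∈ offs L, A κ₁ e₁ κ₂ e₂)
      + (∑ κ₁ : Fin (3 + 1), ∑ e₁ ∈ offs L, ∑ κ₂ : Fin (3 + 1), ∑ e₂ ∈ offs L, B κ₁ e₁ κ₂ e₂) = 0 := by
  have hc : (∑ κ₁ : Fin (3 + 1), ∑ e₁ ∈ offs L, ∑ κ₂ : Fin (3 + 1), ∑ e₂ ∈ offs L, (A κ₁ e₁ κ₂ e₂ + B κ₁ e₁ κ₂ e₂)) = 0 :=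
    Finset.sum_eq_zero fun a _ => Finset.sum_eq_zero fun b _ => Finset.sum_eq_zero fun c _ => Finset.sum_eq_zero fun e _ => h a b c e
  simpa only [Finset.sum_add_distrib] using hc

/-- [folklore] **THE DEPTH-2 COMPOSITE MIXED KERNEL OVER an1's SYM BRICKS, FIVE SUMMANDS WITH THE DEPTH-1 COMPOSITES REPLACED BY BRICKS** (`compMixKer_succ` at `m = 1`;
`compLinKer … 1 f b = ℓ(b; f)`, `compVHKer ℓ 𝓋 … 1 = 𝓋`, `compVHKer ℓ 𝒽 … 1 = 𝒽`, `compMixKer … 1 = 𝓉` — F3∕F5∕F6c's anchors). -/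
theorem compMixKer_two_eq (μ : Fin (3 + 1)) (y : Site (3 + 1)) (g f f' : Bond (3 + 1)) :
    compMixKer (fun _ => symLinKerAt (ctr 4 Lc) Lc) (fun _ => symVhKerAt (ctr 4 Lc) Lc) (fun _ => symHessKerAt (ctr 4 Lc) Lc) (fun _ => symMixKerAt (ctr 4 Lc) Lc) Lc 2 μ y g f f'
      = (∑ κ : Fin (3 + 1), ∑ e ∈ offs Lc, ∑ κ₁ : Fin (3 + 1), ∑ e₁ ∈ offs Lc, ∑ κ₂ : Fin (3 + 1), ∑ e₂ ∈ offs Lc,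
          symMixKerAt (ctr 4 Lc) Lc μ y (κ, (Lc : ℤ) • y + e) (κ₁, (Lc : ℤ) • y + e₁) (κ₂, (Lc : ℤ) • y + e₂)
            * symLinKerAt (ctr 4 Lc) Lc κ ((Lc : ℤ) • y + e) g * symLinKerAt (ctr 4 Lc) Lc κ₁ ((Lc : ℤ) • y + e₁) f
            * symLinKerAt (ctr 4 Lc) Lc κ₂ ((Lc : ℤ) • y + e₂) f')
        + (∑ κ₁ : Fin (3 + 1), ∑ e₁ ∈ offs Lc, ∑ κ₂ : Fin (3 + 1), ∑ e₂ ∈ offs Lc,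
            symHessKerAt (ctr 4 Lc) Lc μ y (κ₁, (Lc : ℤ) • y + e₁) (κ₂, (Lc : ℤ) • y + e₂)
              * symVhKerAt (ctr 4 Lc) Lc κ₁ ((Lc : ℤ) • y + e₁) f g * symLinKerAt (ctr 4 Lc) Lc κ₂ ((Lc : ℤ) • y + e₂) f')
        + (∑ κ₁ : Fin (3 + 1), ∑ e₁ ∈ offs Lc, ∑ κ₂ : Fin (3 + 1), ∑ e₂ ∈ offs Lc,
            symHessKerAt (ctr 4 Lc) Lc μ y (κ₁, (Lc : ℤ) • y + e₁) (κ₂, (Lc : ℤ) • y + e₂)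
              * symLinKerAt (ctr 4 Lc) Lc κ₁ ((Lc : ℤ) • y + e₁) f * symVhKerAt (ctr 4 Lc) Lc κ₂ ((Lc : ℤ) • y + e₂) f' g)
        + (∑ κ₁ : Fin (3 + 1), ∑ e₁ ∈ offs Lc, ∑ κ : Fin (3 + 1), ∑ e ∈ offs Lc,
            symVhKerAt (ctr 4 Lc) Lc μ y (κ₁, (Lc : ℤ) • y + e₁) (κ, (Lc : ℤ) • y + e)
              * symHessKerAt (ctr 4 Lc) Lc κ₁ ((Lc : ℤ) • y + e₁) f f' * symLinKerAt (ctr 4 Lc) Lc κ ((Lc : ℤ) • y + e) g)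
        + ∑ κ : Fin (3 + 1), ∑ e ∈ offs Lc,
            symLinKerAt (ctr 4 Lc) Lc μ y (κ, (Lc : ℤ) • y + e) * symMixKerAt (ctr 4 Lc) Lc κ ((Lc : ℤ) • y + e) g f f' := by
  rw [show (2 : ℕ) = 1 + 1 from rfl, compMixKer_succ]
  simp only [compLinKer_one (symLin_off (Lc := Lc)), compVHKer_one (symVh_off_left (Lc := Lc)) (symVh_off_right (Lc := Lc)),
    compVHKer_one (symHess_off_left (Lc := Lc)) (symHess_off_right (Lc := Lc)),
    compMixKer_one (symMix_off₁ (Lc := Lc)) (symMix_off₂ (Lc := Lc)) (symMix_off₃ (Lc := Lc))]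

omit [NeZero Lc] in
/-- [folklore] **PARITY KILL (S2+S3)**: the two `𝒽`-fed summands are each other's NEGATIVE TRANSPOSE in the fluctuation pair (`symHessKerAt_swap`), so their even half vanishes:
`S2(g;f,f′) + S3(g;f,f′) + S2(g;f′,f) + S3(g;f′,f) = 0`. -/
theorem even_S23_eq_zero (μ : Fin (3 + 1)) (y : Site (3 + 1)) (g f f' : Bond (3 + 1)) :
    (∑ κ₁ : Fin (3 + 1), ∑ e₁ ∈ offs Lc, ∑ κ₂ : Fin (3 + 1), ∑ e₂ ∈ offs Lc,
        symHessKerAt (ctr 4 Lc) Lc μ y (κ₁, (Lc : ℤ) • y + e₁) (κ₂, (Lc : ℤ) • y + e₂)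
          * symVhKerAt (ctr 4 Lc) Lc κ₁ ((Lc : ℤ) • y + e₁) f g * symLinKerAt (ctr 4 Lc) Lc κ₂ ((Lc : ℤ) • y + e₂) f')
      + (∑ κ₁ : Fin (3 + 1), ∑ e₁ ∈ offs Lc, ∑ κ₂ : Fin (3 + 1), ∑ e₂ ∈ offs Lc,
        symHessKerAt (ctr 4 Lc) Lc μ y (κ₁, (Lc : ℤ) • y + e₁) (κ₂, (Lc : ℤ) • y + e₂)
          * symLinKerAt (ctr 4 Lc) Lc κ₁ ((Lc : ℤ) • y + e₁) f * symVhKerAt (ctr 4 Lc) Lc κ₂ ((Lc : ℤ) • y + e₂) f' g)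
      + (∑ κ₁ : Fin (3 + 1), ∑ e₁ ∈ offs Lc, ∑ κ₂ : Fin (3 + 1), ∑ e₂ ∈ offs Lc,
        symHessKerAt (ctr 4 Lc) Lc μ y (κ₁, (Lc : ℤ) • y + e₁) (κ₂, (Lc : ℤ) • y + e₂)
          * symVhKerAt (ctr 4 Lc) Lc κ₁ ((Lc : ℤ) • y + e₁) f' g * symLinKerAt (ctr 4 Lc) Lc κ₂ ((Lc : ℤ) • y + e₂) f)
      + (∑ κ₁ : Fin (3 + 1), ∑ e₁ ∈ offs Lc, ∑ κ₂ : Fin (3 + 1), ∑ e₂ ∈ offs Lc,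
        symHessKerAt (ctr 4 Lc) Lc μ y (κ₁, (Lc : ℤ) • y + e₁) (κ₂, (Lc : ℤ) • y + e₂)
          * symLinKerAt (ctr 4 Lc) Lc κ₁ ((Lc : ℤ) • y + e₁) f' * symVhKerAt (ctr 4 Lc) Lc κ₂ ((Lc : ℤ) • y + e₂) f g) = 0 := by
  -- swap the bond pair in the 2nd and 4th sums: termwise they become the negatives of the 3rd and 1st
  rw [sum4_swap (fun κ₁ e₁ κ₂ e₂ => symHessKerAt (ctr 4 Lc) Lc μ y (κ₁, (Lc : ℤ) • y + e₁) (κ₂, (Lc : ℤ) • y + e₂)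
          * symLinKerAt (ctr 4 Lc) Lc κ₁ ((Lc : ℤ) • y + e₁) f * symVhKerAt (ctr 4 Lc) Lc κ₂ ((Lc : ℤ) • y + e₂) f' g),
    sum4_swap (fun κ₁ e₁ κ₂ e₂ => symHessKerAt (ctr 4 Lc) Lc μ y (κ₁, (Lc : ℤ) • y + e₁) (κ₂, (Lc : ℤ) • y + e₂)
          * symLinKerAt (ctr 4 Lc) Lc κ₁ ((Lc : ℤ) • y + e₁) f' * symVhKerAt (ctr 4 Lc) Lc κ₂ ((Lc : ℤ) • y + e₂) f g)]
  refine sum4_eq_zero_of_add4 _ _ _ _ fun κ₁ e₁ κ₂ e₂ => ?_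
  rw [symHessKerAt_swap (ctr 4 Lc) Lc μ y (κ₁, (Lc : ℤ) • y + e₁) (κ₂, (Lc : ℤ) • y + e₂)]
  ring

omit [NeZero Lc] in
/-- [folklore] **PARITY KILL (S4)**: the `𝓋`-fed summand carries the lower Hessian brick, antisymmetric in the fluctuation pair: `S4(g;f,f′) + S4(g;f′,f) = 0`. -/
theorem even_S4_eq_zero (μ : Fin (3 + 1)) (y : Site (3 + 1)) (g f f' : Bond (3 + 1)) :
    (∑ κ₁ : Fin (3 + 1), ∑ e₁ ∈ offs Lc, ∑ κ : Fin (3 + 1), ∑ e ∈ offs Lc,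
        symVhKerAt (ctr 4 Lc) Lc μ y (κ₁, (Lc : ℤ) • y + e₁) (κ, (Lc : ℤ) • y + e)
          * symHessKerAt (ctr 4 Lc) Lc κ₁ ((Lc : ℤ) • y + e₁) f f' * symLinKerAt (ctr 4 Lc) Lc κ ((Lc : ℤ) • y + e) g)
      + (∑ κ₁ : Fin (3 + 1), ∑ e₁ ∈ offs Lc, ∑ κ : Fin (3 + 1), ∑ e ∈ offs Lc,
        symVhKerAt (ctr 4 Lc) Lc μ y (κ₁, (Lc : ℤ) • y + e₁) (κ, (Lc : ℤ) • y + e)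
          * symHessKerAt (ctr 4 Lc) Lc κ₁ ((Lc : ℤ) • y + e₁) f' f * symLinKerAt (ctr 4 Lc) Lc κ ((Lc : ℤ) • y + e) g) = 0 := by
  refine sum4_eq_zero_of_add2 _ _ fun κ₁ e₁ κ e => ?_
  rw [symHessKerAt_swap (ctr 4 Lc) Lc κ₁ ((Lc : ℤ) • y + e₁) f f']
  ring

/-- [folklore] **THE EVEN HALF OF THE DEPTH-2 COMPOSITE MIXED KERNEL IS `even(S1) + even(S5)`** (pointwise in the background bond `g`). -/
theorem compMixKer_two_even_eq (μ : Fin (3 + 1)) (y : Site (3 + 1)) (g f f' : Bond (3 + 1)) :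
    compMixKer (fun _ => symLinKerAt (ctr 4 Lc) Lc) (fun _ => symVhKerAt (ctr 4 Lc) Lc) (fun _ => symHessKerAt (ctr 4 Lc) Lc) (fun _ => symMixKerAt (ctr 4 Lc) Lc) Lc 2 μ y g f f'
      + compMixKer (fun _ => symLinKerAt (ctr 4 Lc) Lc) (fun _ => symVhKerAt (ctr 4 Lc) Lc) (fun _ => symHessKerAt (ctr 4 Lc) Lc) (fun _ => symMixKerAt (ctr 4 Lc) Lc) Lc 2 μ y g f' f
      = (∑ κ : Fin (3 + 1), ∑ e ∈ offs Lc, ∑ κ₁ : Fin (3 + 1), ∑ e₁ ∈ offs Lc, ∑ κ₂ : Fin (3 + 1), ∑ e₂ ∈ offs Lc,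
          (symMixKerAt (ctr 4 Lc) Lc μ y (κ, (Lc : ℤ) • y + e) (κ₁, (Lc : ℤ) • y + e₁) (κ₂, (Lc : ℤ) • y + e₂)
            + symMixKerAt (ctr 4 Lc) Lc μ y (κ, (Lc : ℤ) • y + e) (κ₂, (Lc : ℤ) • y + e₂) (κ₁, (Lc : ℤ) • y + e₁))
            * symLinKerAt (ctr 4 Lc) Lc κ ((Lc : ℤ) • y + e) g * symLinKerAt (ctr 4 Lc) Lc κ₁ ((Lc : ℤ) • y + e₁) f
            * symLinKerAt (ctr 4 Lc) Lc κ₂ ((Lc : ℤ) • y + e₂) f')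
        + ∑ κ : Fin (3 + 1), ∑ e ∈ offs Lc,
            symLinKerAt (ctr 4 Lc) Lc μ y (κ, (Lc : ℤ) • y + e)
              * (symMixKerAt (ctr 4 Lc) Lc κ ((Lc : ℤ) • y + e) g f f' + symMixKerAt (ctr 4 Lc) Lc κ ((Lc : ℤ) • y + e) g f' f) := by
  have h23 := even_S23_eq_zero (Lc := Lc) μ y g f f'
  have h4 := even_S4_eq_zero (Lc := Lc) μ y g f f'
  -- re-index the swapped S1 so that the transported legs are `ℓ(b₁;f) ℓ(b₂;f′)` in both halves
  have swap6 : (∑ κ : Fin (3 + 1), ∑ e ∈ offs Lc, ∑ κ₁ : Fin (3 + 1), ∑ e₁ ∈ offs Lc, ∑ κ₂ : Fin (3 + 1), ∑ e₂ ∈ offs Lc,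
          symMixKerAt (ctr 4 Lc) Lc μ y (κ, (Lc : ℤ) • y + e) (κ₁, (Lc : ℤ) • y + e₁) (κ₂, (Lc : ℤ) • y + e₂)
            * symLinKerAt (ctr 4 Lc) Lc κ ((Lc : ℤ) • y + e) g * symLinKerAt (ctr 4 Lc) Lc κ₁ ((Lc : ℤ) • y + e₁) f'
            * symLinKerAt (ctr 4 Lc) Lc κ₂ ((Lc : ℤ) • y + e₂) f)
      = ∑ κ : Fin (3 + 1), ∑ e ∈ offs Lc, ∑ κ₁ : Fin (3 + 1), ∑ e₁ ∈ offs Lc, ∑ κ₂ : Fin (3 + 1), ∑ e₂ ∈ offs Lc,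
          symMixKerAt (ctr 4 Lc) Lc μ y (κ, (Lc : ℤ) • y + e) (κ₂, (Lc : ℤ) • y + e₂) (κ₁, (Lc : ℤ) • y + e₁)
            * symLinKerAt (ctr 4 Lc) Lc κ ((Lc : ℤ) • y + e) g * symLinKerAt (ctr 4 Lc) Lc κ₁ ((Lc : ℤ) • y + e₁) f
            * symLinKerAt (ctr 4 Lc) Lc κ₂ ((Lc : ℤ) • y + e₂) f' := by
    refine Finset.sum_congr rfl fun κ _ => Finset.sum_congr rfl fun e _ => ?_
    rw [sum4_swap (fun κ₁ e₁ κ₂ e₂ => symMixKerAt (ctr 4 Lc) Lc μ y (κ, (Lc : ℤ) • y + e) (κ₁, (Lc : ℤ) • y + e₁) (κ₂, (Lc : ℤ) • y + e₂)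
            * symLinKerAt (ctr 4 Lc) Lc κ ((Lc : ℤ) • y + e) g * symLinKerAt (ctr 4 Lc) Lc κ₁ ((Lc : ℤ) • y + e₁) f'
            * symLinKerAt (ctr 4 Lc) Lc κ₂ ((Lc : ℤ) • y + e₂) f)]
    refine Finset.sum_congr rfl fun κ₁ _ => Finset.sum_congr rfl fun e₁ _ => Finset.sum_congr rfl fun κ₂ _ => Finset.sum_congr rfl fun e₂ _ => ?_
    ring
  rw [compMixKer_two_eq, compMixKer_two_eq, swap6]
  simp only [add_mul, mul_add, Finset.sum_add_distrib]
  linear_combination h23 + h4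

omit [NeZero Lc] in
/-- [folklore] moving the first bond pair of a six-fold window sum innermost (eight adjacent exchanges). -/
theorem sum6_push2 {L : ℕ} (F : Fin (3 + 1) → Site (3 + 1) → Fin (3 + 1) → Site (3 + 1) → Fin (3 + 1) → Site (3 + 1) → ℝ) :
    (∑ κ : Fin (3 + 1), ∑ e ∈ offs L, ∑ κ₁ : Fin (3 + 1), ∑ e₁ ∈ offs L, ∑ κ₂ : Fin (3 + 1), ∑ e₂ ∈ offs L, F κ e κ₁ e₁ κ₂ e₂)
      = (∑ κ₁ : Fin (3 + 1), ∑ e₁ ∈ offs L, ∑ κ₂ : Fin (3 + 1), ∑ e₂ ∈ offs L, ∑ κ : Fin (3 + 1), ∑ e ∈ offs L, F κ e κ₁ e₁ κ₂ e₂) := by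
  have s1 : (∑ κ : Fin (3 + 1), ∑ e ∈ offs L, ∑ κ₁ : Fin (3 + 1), ∑ e₁ ∈ offs L, ∑ κ₂ : Fin (3 + 1), ∑ e₂ ∈ offs L, F κ e κ₁ e₁ κ₂ e₂)
      = (∑ κ : Fin (3 + 1), ∑ κ₁ : Fin (3 + 1), ∑ e ∈ offs L, ∑ e₁ ∈ offs L, ∑ κ₂ : Fin (3 + 1), ∑ e₂ ∈ offs L, F κ e κ₁ e₁ κ₂ e₂) :=
    Finset.sum_congr rfl fun κ _ => Finset.sum_comm
  have s2 : (∑ κ : Fin (3 + 1), ∑ κ₁ : Fin (3 + 1), ∑ e ∈ offs L, ∑ e₁ ∈ offs L, ∑ κ₂ : Fin (3 + 1), ∑ e₂ ∈ offs L, F κ e κ₁ e₁ κ₂ e₂)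
      = (∑ κ : Fin (3 + 1), ∑ κ₁ : Fin (3 + 1), ∑ e₁ ∈ offs L, ∑ e ∈ offs L, ∑ κ₂ : Fin (3 + 1), ∑ e₂ ∈ offs L, F κ e κ₁ e₁ κ₂ e₂) :=
    Finset.sum_congr rfl fun κ _ => Finset.sum_congr rfl fun κ₁ _ => Finset.sum_comm
  have s3 : (∑ κ : Fin (3 + 1), ∑ κ₁ : Fin (3 + 1), ∑ e₁ ∈ offs L, ∑ e ∈ offs L, ∑ κ₂ : Fin (3 + 1), ∑ e₂ ∈ offs L, F κ e κ₁ e₁ κ₂ e₂)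
      = (∑ κ : Fin (3 + 1), ∑ κ₁ : Fin (3 + 1), ∑ e₁ ∈ offs L, ∑ κ₂ : Fin (3 + 1), ∑ e ∈ offs L, ∑ e₂ ∈ offs L, F κ e κ₁ e₁ κ₂ e₂) :=
    Finset.sum_congr rfl fun κ _ => Finset.sum_congr rfl fun κ₁ _ => Finset.sum_congr rfl fun e₁ _ => Finset.sum_comm
  have s4 : (∑ κ : Fin (3 + 1), ∑ κ₁ : Fin (3 + 1), ∑ e₁ ∈ offs L, ∑ κ₂ : Fin (3 + 1), ∑ e ∈ offs L, ∑ e₂ ∈ offs L, F κ e κ₁ e₁ κ₂ e₂)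
      = (∑ κ : Fin (3 + 1), ∑ κ₁ : Fin (3 + 1), ∑ e₁ ∈ offs L, ∑ κ₂ : Fin (3 + 1), ∑ e₂ ∈ offs L, ∑ e ∈ offs L, F κ e κ₁ e₁ κ₂ e₂) :=
    Finset.sum_congr rfl fun κ _ => Finset.sum_congr rfl fun κ₁ _ => Finset.sum_congr rfl fun e₁ _ => Finset.sum_congr rfl fun κ₂ _ => Finset.sum_comm
  have s5 : (∑ κ : Fin (3 + 1), ∑ κ₁ : Fin (3 + 1), ∑ e₁ ∈ offs L, ∑ κ₂ : Fin (3 + 1), ∑ e₂ ∈ offs L, ∑ e ∈ offs L, F κ e κ₁ e₁ κ₂ e₂)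
      = (∑ κ₁ : Fin (3 + 1), ∑ κ : Fin (3 + 1), ∑ e₁ ∈ offs L, ∑ κ₂ : Fin (3 + 1), ∑ e₂ ∈ offs L, ∑ e ∈ offs L, F κ e κ₁ e₁ κ₂ e₂) :=
    Finset.sum_comm
  have s6 : (∑ κ₁ : Fin (3 + 1), ∑ κ : Fin (3 + 1), ∑ e₁ ∈ offs L, ∑ κ₂ : Fin (3 + 1), ∑ e₂ ∈ offs L, ∑ e ∈ offs L, F κ e κ₁ e₁ κ₂ e₂)
      = (∑ κ₁ : Fin (3 + 1), ∑ e₁ ∈ offs L, ∑ κ : Fin (3 + 1), ∑ κ₂ : Fin (3 + 1), ∑ e₂ ∈ offs L, ∑ e ∈ offs L, F κ e κ₁ e₁ κ₂ e₂) :=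
    Finset.sum_congr rfl fun κ₁ _ => Finset.sum_comm
  have s7 : (∑ κ₁ : Fin (3 + 1), ∑ e₁ ∈ offs L, ∑ κ : Fin (3 + 1), ∑ κ₂ : Fin (3 + 1), ∑ e₂ ∈ offs L, ∑ e ∈ offs L, F κ e κ₁ e₁ κ₂ e₂)
      = (∑ κ₁ : Fin (3 + 1), ∑ e₁ ∈ offs L, ∑ κ₂ : Fin (3 + 1), ∑ κ : Fin (3 + 1), ∑ e₂ ∈ offs L, ∑ e ∈ offs L, F κ e κ₁ e₁ κ₂ e₂) :=
    Finset.sum_congr rfl fun κ₁ _ => Finset.sum_congr rfl fun e₁ _ => Finset.sum_comm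
  have s8 : (∑ κ₁ : Fin (3 + 1), ∑ e₁ ∈ offs L, ∑ κ₂ : Fin (3 + 1), ∑ κ : Fin (3 + 1), ∑ e₂ ∈ offs L, ∑ e ∈ offs L, F κ e κ₁ e₁ κ₂ e₂)
      = (∑ κ₁ : Fin (3 + 1), ∑ e₁ ∈ offs L, ∑ κ₂ : Fin (3 + 1), ∑ e₂ ∈ offs L, ∑ κ : Fin (3 + 1), ∑ e ∈ offs L, F κ e κ₁ e₁ κ₂ e₂) :=
    Finset.sum_congr rfl fun κ₁ _ => Finset.sum_congr rfl fun e₁ _ => Finset.sum_congr rfl fun κ₂ _ => Finset.sum_comm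
  rw [s1, s2, s3, s4, s5, s6, s7, s8]

end Summit.QuantumFields.BalabanUV.Beta.CombMixedT2EvenStoreyTwoLetters

end
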